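import Summits.NavierStokesRegularity.TurbBounds.ShearSpecPieces
import Mathlib.Data.List.GetD
import Mathlib.Algebra.BigOperators.Group.List.Basic
import Mathlib.Algebra.BigOperators.Group.Finset.Basic
import Mathlib.Tactic.Ring
import HarnessLib

/-!
# Entry semantics of the `ShearSpecPieces` tables (closed forms for `get2`) — groundwork for the fw16 Legendre–Galerkin bridge (v2)

Cell `turb-bounds` (pub-turb), shear lane, pub-turb-shear gen 6 (2026-08-22); v2 lane. `ShearSpecPieces` computes the rbsdp SPEC §2 tables by
sparsity-aware list folds (so that `decide +kernel` can match them with the literal certificate pieces). For the ANALYTIC bridge one needs what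
the entries ARE as sums; this file proves the generic part once: `getD_axpy`, `get2_gramAdd`, `get2_outerAdd`, `get2_matAdd`,
`get2_matScale`, `get2_diagMat`, the fold lemmas `get2_foldl_gramAdd` (a Gram sum `G₀ + Σ w_n r_n r_nᵀ` entrywise) and `getD_foldl_axpy_filter`
(a filtered linear combination of rows entrywise = the unfiltered sum), the indexing lemmas `zip_range_eq_map_getD` / `zip_eq_map_getD` /
`sum_map_range` (list sums ↦ `Finset.range` sums), and the ladders `get2_d1Rows`, `getD_d0cRow[']`, `get2_d0cRows`. The tables `Q1, K, E, H1, G0, H0, R`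
and the projection follow in `ShearSpecEntries`.
PURE LIST ALGEBRA over `ℚ`; no analysis. HONEST FRAMING: rigorous bounds for the stated PDE and boundary conditions; no claim about physical turbulence beyond the bound.
-/

set_option linter.style.longLine false

namespace Summit.NavierStokesRegularity.TurbBounds.ShearSpecPieces

open List

/-! ### generic `getD` helpers -/

/-- `getD` of a `map` over `range`. -/
theorem getD_map_range {α : Type*} (f : ℕ → α) (n i : ℕ) (dflt : α) :
    List.getD (List.map f (List.range n)) i dflt = if i < n then f i else dflt := by
  simp only [List.getD_eq_getElem?_getD, List.getElem?_map]
  split_ifs with h <;> simp [h]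

/-- `getD` of a `zipWith` inside the common range (GramStream's lemma, restated for convenience). -/
theorem getD_zipWith' {α β γ : Type*} (f : α → β → γ) (da : α) (db : β) (dc : γ) (l : List α) (l' : List β) (i : ℕ)
    (h1 : i < l.length) (h2 : i < l'.length) : (List.zipWith f l l').getD i dc = f (l.getD i da) (l'.getD i db) := by
  simp only [List.getD_eq_getElem?_getD, List.getElem?_zipWith]
  rw [List.getElem?_eq_getElem h1, List.getElem?_eq_getElem h2]
  rfl

/-- `getD` of a `zipWith` beyond the common range. -/
theorem getD_zipWith_of_le {α β γ : Type*} (f : α → β → γ) (dc : γ) (l : List α) (l' : List β) (i : ℕ)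
    (h : min l.length l'.length ≤ i) : (List.zipWith f l l').getD i dc = dc :=
  List.getD_eq_default _ _ (by simpa [List.length_zipWith] using h)

/-! ### `axpy`, `zeroVec` -/

/-- `zeroVec` entries are `0`. -/
theorem getD_zeroVec (L j : ℕ) : (zeroVec L).getD j 0 = (0 : ℚ) := by
  unfold zeroVec
  simp only [List.getD_eq_getElem?_getD, List.getElem?_replicate]
  split_ifs <;> simp

/-- Length of `axpy`. -/
theorem length_axpy (a : ℚ) (x y : List ℚ) : (axpy a x y).length = min x.length y.length := by
  unfold axpy; simp

/-- **`axpy` entrywise**: `(a•x + y)_j = a·x_j + y_j` (equal lengths; the zero-skip is invisible). -/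
theorem getD_axpy (a : ℚ) (x y : List ℚ) (h : x.length = y.length) (j : ℕ) :
    (axpy a x y).getD j 0 = a * x.getD j 0 + y.getD j 0 := by
  unfold axpy
  by_cases hj : j < x.length
  · rw [getD_zipWith' _ 0 0 0 _ _ _ hj (h ▸ hj)]
    split_ifs with h0
    · rw [h0]; ring
    · rfl
  · have hj : x.length ≤ j := not_lt.mp hj
    rw [getD_zipWith_of_le _ _ _ _ _ (by simp [← h, hj]), List.getD_eq_default _ _ hj, List.getD_eq_default _ _ (h ▸ hj)]
    ring

/-! ### matrices as row lists: `get2` of the constructors -/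

/-- `get2` unfolds to two `getD`s. -/
theorem get2_eq (M : List (List ℚ)) (r s : ℕ) : get2 M r s = (M.getD r []).getD s 0 := rfl

/-- Outside the rows, `get2 = 0`. -/
theorem get2_of_le (M : List (List ℚ)) {r : ℕ} (hr : M.length ≤ r) (s : ℕ) : get2 M r s = 0 := by
  rw [get2_eq, List.getD_eq_default _ _ hr]; rfl

/-- `zeroMat` entries are `0`. -/
theorem get2_zeroMat (r c i j : ℕ) : get2 (zeroMat r c) i j = 0 := by
  unfold zeroMat get2
  simp only [List.getD_eq_getElem?_getD, List.getElem?_replicate]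
  split_ifs
  · simpa [List.getD_eq_getElem?_getD] using getD_zeroVec c j
  · simp

/-- A row-list matrix is `n × c`-shaped. -/
def Shaped (n c : ℕ) (M : List (List ℚ)) : Prop := M.length = n ∧ ∀ r < n, (M.getD r []).length = c

/-- `zeroMat r c` is shaped. -/
theorem shaped_zeroMat (r c : ℕ) : Shaped r c (zeroMat r c) := by
  refine ⟨by simp [zeroMat], fun i hi => ?_⟩
  unfold zeroMat
  rw [List.getD_eq_getElem _ _ (by simpa using hi)]
  simp [zeroVec]

/-- **`gramAdd` entrywise**: `(G + w·x xᵀ)[r][s] = G[r][s] + w·x_r·x_s` (`x` of length `n`, `G` shaped `n × n`). -/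
theorem get2_gramAdd (w : ℚ) (x : List ℚ) (G : List (List ℚ)) {n : ℕ} (hx : x.length = n) (hG : Shaped n n G) (r s : ℕ) :
    get2 (gramAdd w x G) r s = get2 G r s + w * x.getD r 0 * x.getD s 0 := by
  unfold gramAdd
  by_cases hr : r < n
  · rw [get2_eq, getD_zipWith' _ 0 [] [] _ _ _ (hx ▸ hr) (hG.1 ▸ hr)]
    split_ifs with h0
    · rw [h0, get2_eq]; ring
    · rw [getD_axpy _ _ _ (by rw [hx, hG.2 r hr]), get2_eq]; ring
  · have hr : n ≤ r := not_lt.mp hr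
    have h1 : get2 (List.zipWith (fun xi Gi => if xi = 0 then Gi else axpy (w * xi) x Gi) x G) r s = 0 :=
      get2_of_le _ (by simp [hx, hG.1, hr]) s
    have h2 : get2 G r s = 0 := get2_of_le _ (by rw [hG.1]; exact hr) s
    have h3 : x.getD r 0 = 0 := List.getD_eq_default _ _ (by rw [hx]; exact hr)
    rw [h1, h2, h3]; ring

/-- `gramAdd` preserves the shape. -/
theorem shaped_gramAdd (w : ℚ) (x : List ℚ) (G : List (List ℚ)) {n : ℕ} (hx : x.length = n) (hG : Shaped n n G) :
    Shaped n n (gramAdd w x G) := by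
  refine ⟨by simp [gramAdd, hx, hG.1], fun r hr => ?_⟩
  unfold gramAdd
  rw [getD_zipWith' _ 0 [] [] _ _ _ (hx ▸ hr) (hG.1 ▸ hr)]
  split_ifs
  · exact hG.2 r hr
  · rw [length_axpy, hx, hG.2 r hr, min_self]

/-- **`outerAdd` entrywise**: `(G + x yᵀ)[r][s] = G[r][s] + x_r·y_s` (`x` of length `n`, `y` of length `c`, `G` shaped `n × c`). -/
theorem get2_outerAdd (x y : List ℚ) (G : List (List ℚ)) {n c : ℕ} (hx : x.length = n) (hy : y.length = c) (hG : Shaped n c G)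
    (r s : ℕ) : get2 (outerAdd x y G) r s = get2 G r s + x.getD r 0 * y.getD s 0 := by
  unfold outerAdd
  by_cases hr : r < n
  · rw [get2_eq, getD_zipWith' _ 0 [] [] _ _ _ (hx ▸ hr) (hG.1 ▸ hr)]
    split_ifs with h0
    · rw [h0, get2_eq]; ring
    · rw [getD_axpy _ _ _ (by rw [hy, hG.2 r hr]), get2_eq]; ring
  · have hr : n ≤ r := not_lt.mp hr
    have h1 : get2 (List.zipWith (fun xi Gi => if xi = 0 then Gi else axpy xi y Gi) x G) r s = 0 :=
      get2_of_le _ (by simp [hx, hG.1, hr]) s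
    have h2 : get2 G r s = 0 := get2_of_le _ (by rw [hG.1]; exact hr) s
    have h3 : x.getD r 0 = 0 := List.getD_eq_default _ _ (by rw [hx]; exact hr)
    rw [h1, h2, h3]; ring

/-- `outerAdd` preserves the shape. -/
theorem shaped_outerAdd (x y : List ℚ) (G : List (List ℚ)) {n c : ℕ} (hx : x.length = n) (hy : y.length = c) (hG : Shaped n c G) :
    Shaped n c (outerAdd x y G) := by
  refine ⟨by simp [outerAdd, hx, hG.1], fun r hr => ?_⟩
  unfold outerAdd
  rw [getD_zipWith' _ 0 [] [] _ _ _ (hx ▸ hr) (hG.1 ▸ hr)]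
  split_ifs
  · exact hG.2 r hr
  · rw [length_axpy, hy, hG.2 r hr, min_self]

/-- **`matAdd` entrywise** (same shape). -/
theorem get2_matAdd (G H : List (List ℚ)) {n c : ℕ} (hG : Shaped n c G) (hH : Shaped n c H) (r s : ℕ) :
    get2 (matAdd G H) r s = get2 G r s + get2 H r s := by
  unfold matAdd
  by_cases hr : r < n
  · rw [get2_eq, getD_zipWith' _ [] [] [] _ _ _ (hG.1 ▸ hr) (hH.1 ▸ hr)]
    by_cases hs : s < c
    · rw [getD_zipWith' _ 0 0 0 _ _ _ (by rw [hG.2 r hr]; exact hs) (by rw [hH.2 r hr]; exact hs)]; rfl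
    · have hs : c ≤ s := not_lt.mp hs
      rw [getD_zipWith_of_le _ _ _ _ _ (by rw [hG.2 r hr, hH.2 r hr, min_self]; exact hs), get2_eq, get2_eq,
        List.getD_eq_default _ _ (by rw [hG.2 r hr]; exact hs), List.getD_eq_default _ _ (by rw [hH.2 r hr]; exact hs)]
      simp
  · have hr : n ≤ r := not_lt.mp hr
    rw [get2_eq, getD_zipWith_of_le _ _ _ _ _ (by simp [hG.1, hH.1, hr]), get2_of_le _ (hG.1 ▸ hr), get2_of_le _ (hH.1 ▸ hr)]
    simp

/-- **`matScale` entrywise**. -/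
theorem get2_matScale (a : ℚ) (G : List (List ℚ)) (r s : ℕ) : get2 (matScale a G) r s = a * get2 G r s := by
  unfold matScale
  simp only [get2_eq, List.getD_eq_getElem?_getD, List.getElem?_map]
  rcases G[r]? with _ | row
  · simp
  · simp only [Option.map_some, Option.getD_some, List.getElem?_map]
    rcases row[s]? with _ | v
    · simp
    · simp

/-- **`diagMat` entrywise**: `diag(v)[r][s] = [r = s]·v_r` (for all `r, s`). -/
theorem get2_diagMat (v : List ℚ) (r s : ℕ) : get2 (diagMat v) r s = if r = s then v.getD r 0 else 0 := by
  unfold diagMat get2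
  rw [getD_map_range]
  split_ifs with h1 h2 h2
  · rw [getD_map_range, if_pos (h2 ▸ h1), if_pos h2]
  · rw [getD_map_range]
    split_ifs with h3
    · rfl
    · rfl
  · subst h2
    rw [List.getD_eq_default _ _ (not_lt.mp h1)]; rfl
  · rfl

/-! ### folds -/

/-- **A Gram fold entrywise**: `(L.foldl (fun G nr => gramAdd (wt nr.1) nr.2 G) G₀)[r][s] = G₀[r][s] + Σ_{nr ∈ L} wt(nr.1)·(nr.2)_r·(nr.2)_s`
(all rows in `L` of length `n`, `G₀` shaped `n × n`). -/
theorem get2_foldl_gramAdd (wt : ℕ × List ℚ → ℚ) {n : ℕ} :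
    ∀ (L : List (ℕ × List ℚ)) (G₀ : List (List ℚ)), (∀ nr ∈ L, nr.2.length = n) → Shaped n n G₀ → ∀ r s,
      get2 (L.foldl (fun G nr => gramAdd (wt nr) nr.2 G) G₀) r s
        = get2 G₀ r s + (L.map fun nr => wt nr * nr.2.getD r 0 * nr.2.getD s 0).sum
  | [], G₀, _, _, r, s => by simp
  | nr :: L, G₀, hL, hG, r, s => by
      rw [List.foldl_cons, get2_foldl_gramAdd wt L _ (fun x hx => hL x (List.mem_cons_of_mem _ hx))
        (shaped_gramAdd _ _ _ (hL nr List.mem_cons_self) hG), get2_gramAdd _ _ _ (hL nr List.mem_cons_self) hG]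
      simp only [List.map_cons, List.sum_cons]
      ring

/-- Shape of a Gram fold. -/
theorem shaped_foldl_gramAdd (wt : ℕ × List ℚ → ℚ) {n : ℕ} :
    ∀ (L : List (ℕ × List ℚ)) (G₀ : List (List ℚ)), (∀ nr ∈ L, nr.2.length = n) → Shaped n n G₀ →
      Shaped n n (L.foldl (fun G nr => gramAdd (wt nr) nr.2 G) G₀)
  | [], G₀, _, hG => hG
  | nr :: L, G₀, hL, hG => by
      rw [List.foldl_cons]
      exact shaped_foldl_gramAdd wt L _ (fun x hx => hL x (List.mem_cons_of_mem _ hx)) (shaped_gramAdd _ _ _ (hL nr List.mem_cons_self) hG)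

/-- **A filtered linear combination of rows entrywise**: folding `axpy (c ir) ir.2` over `L.filter (c · ≠ 0)` from `z` gives
`z_j + Σ_{ir ∈ L} c(ir)·(ir.2)_j` — the filter only drops zero terms. -/
theorem getD_foldl_axpy_filter {α : Type*} (c : α × List ℚ → ℚ) {n : ℕ} :
    ∀ (L : List (α × List ℚ)) (z : List ℚ), (∀ ir ∈ L, ir.2.length = n) → z.length = n → ∀ j,
      ((L.filter fun ir => c ir ≠ 0).foldl (fun acc ir => axpy (c ir) ir.2 acc) z).getD j 0
        = z.getD j 0 + (L.map fun ir => c ir * ir.2.getD j 0).sum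
  | [], z, _, _, j => by simp
  | ir :: L, z, hL, hz, j => by
      rw [List.filter_cons]
      by_cases h0 : c ir ≠ 0
      · rw [if_pos (by simpa using h0), List.foldl_cons,
          getD_foldl_axpy_filter c L _ (fun x hx => hL x (List.mem_cons_of_mem _ hx))
            (by rw [length_axpy, hL ir List.mem_cons_self, hz, min_self]),
          getD_axpy _ _ _ (by rw [hL ir List.mem_cons_self, hz])]
        simp only [List.map_cons, List.sum_cons]
        ring
      · rw [if_neg (by simpa using h0), getD_foldl_axpy_filter c L z (fun x hx => hL x (List.mem_cons_of_mem _ hx)) hz]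
        have h0 : c ir = 0 := not_not.mp h0
        simp only [List.map_cons, List.sum_cons, h0]
        ring

/-- Length of a filtered `axpy` fold. -/
theorem length_foldl_axpy_filter {α : Type*} (c : α × List ℚ → ℚ) {n : ℕ} :
    ∀ (L : List (α × List ℚ)) (z : List ℚ), (∀ ir ∈ L, ir.2.length = n) → z.length = n →
      ((L.filter fun ir => c ir ≠ 0).foldl (fun acc ir => axpy (c ir) ir.2 acc) z).length = n
  | [], z, _, hz => by simpa using hz
  | ir :: L, z, hL, hz => by
      rw [List.filter_cons]
      split_ifs
      · rw [List.foldl_cons]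
        exact length_foldl_axpy_filter c L _ (fun x hx => hL x (List.mem_cons_of_mem _ hx))
          (by rw [length_axpy, hL ir List.mem_cons_self, hz, min_self])
      · exact length_foldl_axpy_filter c L z (fun x hx => hL x (List.mem_cons_of_mem _ hx)) hz

/-- `(range n).zip L` as an indexed map (when `L.length = n`). -/
theorem zip_range_eq_map_getD {α : Type*} (L : List α) (d : α) {n : ℕ} (hL : L.length = n) :
    (List.range n).zip L = (List.range n).map fun i => (i, L.getD i d) := by
  apply List.ext_getElem
  · simp [hL]
  · intro k h1 h2
    have hk : k < n := by simpa using h2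
    have hkL : k < L.length := hL ▸ hk
    simp [List.getElem_zip, List.getD_eq_getElem?_getD, List.getElem?_eq_getElem hkL]

/-- `A.zip B` as an indexed map (when both have length `n`). -/
theorem zip_eq_map_getD {α β : Type*} (A : List α) (B : List β) (da : α) (db : β) {n : ℕ} (hA : A.length = n) (hB : B.length = n) :
    A.zip B = (List.range n).map fun i => (A.getD i da, B.getD i db) := by
  apply List.ext_getElem
  · simp [hA, hB]
  · intro k h1 h2
    have hk : k < n := by simpa using h2
    simp [List.getElem_zip, List.getD_eq_getElem?_getD, List.getElem?_eq_getElem (hA ▸ hk), List.getElem?_eq_getElem (hB ▸ hk)]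

/-! ### the ladders `D1`, `D0c` -/

/-- Length of `intRow`. -/
theorem length_intRow (L n : ℕ) : (intRow L n).length = L := by simp [intRow]

/-- `intRow` entrywise. -/
theorem getD_intRow (L n j : ℕ) : (intRow L n).getD j 0 = if j < L then intEntry n j else 0 := by
  unfold intRow; exact getD_map_range _ _ _ _

/-- **`D1` entrywise**: `D1[n][j] = intEntry n j` for `n < N+P+3`, `j < N+P+4`, else `0`. -/
theorem get2_d1Rows (N P n j : ℕ) :
    get2 (d1Rows N P) n j = if n < N + P + 3 ∧ j < N + P + 4 then intEntry n j else 0 := by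
  unfold d1Rows get2
  rw [getD_map_range]
  by_cases hn : n < N + P + 3
  · rw [if_pos hn, getD_intRow]
    by_cases hj : j < N + P + 4
    · rw [if_pos hj, if_pos ⟨hn, hj⟩]
    · rw [if_neg hj, if_neg (fun h => hj h.2)]
  · rw [if_neg hn, if_neg (fun h => hn h.1)]; rfl

/-- Shape of `D1`. -/
theorem length_d1Rows (N P : ℕ) : (d1Rows N P).length = N + P + 3 := by simp [d1Rows]

/-- Rows of `D1` have length `L2`. -/
theorem length_getD_d1Rows (N P n : ℕ) (hn : n < N + P + 3) : ((d1Rows N P).getD n []).length = N + P + 4 := by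
  unfold d1Rows
  rw [List.getD_eq_getElem _ _ (by simpa using hn)]
  simp [length_intRow]

/-- **`D0c` entrywise**: `D0c[n][j] = Σ_{i < N+P+3} intEntry n i · D1[i][j]`. -/
theorem getD_d0cRow (N P n j : ℕ) :
    (d0cRow N P n).getD j 0 = ((List.range (N + P + 3)).map fun i => intEntry n i * get2 (d1Rows N P) i j).sum := by
  unfold d0cRow
  have hL : ∀ ir ∈ (List.range (N + P + 3)).zip (d1Rows N P), ir.2.length = N + P + 4 := by
    intro ir hir
    have h2 := List.of_mem_zip hir
    obtain ⟨k, hk, hk2⟩ := List.getElem_of_mem h2.2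
    rw [← hk2]
    simp only [length_d1Rows] at hk
    have := length_getD_d1Rows N P k hk
    rwa [List.getD_eq_getElem _ _ (by simpa [length_d1Rows] using hk)] at this
  rw [getD_foldl_axpy_filter (fun ir => intEntry n ir.1) _ _ hL (by simp [zeroVec]), getD_zeroVec, zero_add]
  rw [zip_range_eq_map_getD _ [] (length_d1Rows N P), List.map_map]
  rfl

/-- Rows of `D0c`: `get2 (d0cRows N P) n j = (d0cRow N P n)_j` for `n < N+P+2`, else `0`. -/
theorem get2_d0cRows (N P n j : ℕ) : get2 (d0cRows N P) n j = if n < N + P + 2 then (d0cRow N P n).getD j 0 else 0 := by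
  unfold d0cRows get2
  rw [getD_map_range]
  split_ifs <;> rfl

/-- Length of a `D0c` row. -/
theorem length_d0cRow (N P n : ℕ) : (d0cRow N P n).length = N + P + 4 := by
  unfold d0cRow
  refine length_foldl_axpy_filter (fun ir => intEntry n ir.1) _ _ (fun ir hir => ?_) (by simp [zeroVec])
  rw [zip_range_eq_map_getD _ [] (length_d1Rows N P)] at hir
  obtain ⟨i, hi, rfl⟩ := List.mem_map.mp hir
  exact length_getD_d1Rows N P i (by simpa using hi)

/-! ### list sums as `Finset` sums -/

/-- `((range n).map f).sum = ∑_{i<n} f i`. -/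
theorem sum_map_range (f : ℕ → ℚ) (n : ℕ) : List.sum (List.map f (List.range n)) = ∑ i ∈ Finset.range n, f i := by
  induction n with
  | zero => simp
  | succ n ih => rw [List.range_succ, List.map_append, List.sum_append, ih, Finset.sum_range_succ]; simp

open Finset

/-- **`D0c` entrywise as a `Finset` sum.** -/
theorem getD_d0cRow' (N P n j : ℕ) :
    (d0cRow N P n).getD j 0 = ∑ i ∈ range (N + P + 3), intEntry n i * get2 (d1Rows N P) i j := by
  rw [getD_d0cRow, sum_map_range]

end Summit.NavierStokesRegularity.TurbBounds.ShearSpecPieces
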